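import Mathlib
import Literature.RingTheory.CohomologyAnnihilator.BirationalTransfer
import HarnessLib

/-!
# `x`-sandwiched lattices and stable annihilation (card A1: `SandwichLemma`, `SplittingCriterion`)

Crux `HomologicalConductor.Persistence` (stmt-ResolutionOfSingularities-16484), chain W4.4b, card A1
`sandwich-generation` of res-L1-w44b-idea-1 (line L-supply = A1 ∪ B1 of CRUX-PLAN v3 §3.2; ASSIGN v0.7
idea-1 row "then SandwichLemma/BoxLemma/Card1Reduction file", seat ended — the def-free ones taken by
stub-3 successor; `BoxLemma` is res-L1-w44b-idea-2's landed `smul_id_factors_of_mem`, p486322;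
`Card1Reduction` needs the card's `SandwichGeneration` definition and is NOT here). `[OURS · L1 w44b]`
— elementary linear algebra (the card's `FactorsThroughFree` unfolded as `π ∘ ι = x • id` through
`Fin s → C`); NOT a statement of the manuscript under review; AI-drafted (weaker than expert review).

* `exists_comp_eq_smul_id_of_sandwich` — **`SandwichLemma`** (A1·S1): a lattice `M₁ ≤ Cˢ` with
  `x • Cˢ ≤ M₁` has `x • 1_{M₁}` factoring through `Cˢ` (inclusion, then `v ↦ x v ∈ M₁`).
* `exists_sandwich_of_comp_eq_smul_id` — **`SplittingCriterion`** (A1·S0, the converse up to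
  summands): if `π ∘ ι = x • 1_N` through `Cˢ` and `x` is a non-zero-divisor on `N`, then
  `M₁ := ι(N) + ker π` is `x`-sandwiched (`x v = ι π v + (x v - ι π v)`) and `N × ker π ≃ M₁`
  (`(n, k) ↦ ι n + k`; injective because `π` of it is `x n`). So "`x` stably annihilates `N`" iff
  "`N` is a direct summand of an `x`-sandwiched lattice", for `x`-torsion-free `N`.
-/

-- single-problem summit: the doubled namespace component is forced
set_option linter.dupNamespace false

noncomputable section

universe u

namespace Summit.ResolutionOfSingularities.ResolutionOfSingularities.Theorems.HomologicalConductor.PersistenceSandwich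

variable {C : Type u} [CommRing C]

/-- **`SandwichLemma`** (card A1·S1): if `M₁ ≤ Cˢ` contains `x • Cˢ`, then `x • 1_{M₁}` factors
through `Cˢ`: the inclusion followed by `v ↦ x • v ∈ M₁`. [folklore] -/
theorem exists_comp_eq_smul_id_of_sandwich {s : ℕ} (x : C) (M₁ : Submodule C (Fin s → C))
    (hM₁ : ∀ v : Fin s → C, x • v ∈ M₁) :
    ∃ (ι : M₁ →ₗ[C] (Fin s → C)) (π : (Fin s → C) →ₗ[C] M₁), π ∘ₗ ι = x • LinearMap.id := by
  refine ⟨M₁.subtype, LinearMap.codRestrict M₁ (x • LinearMap.id) (fun v => hM₁ v),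
    LinearMap.ext fun m => Subtype.ext ?_⟩
  simp only [LinearMap.comp_apply, LinearMap.codRestrict_apply, Submodule.subtype_apply,
    LinearMap.smul_apply, LinearMap.id_apply, Submodule.coe_smul_of_tower]

/-- **`SplittingCriterion`** (card A1·S0): if `π ∘ ι = x • 1_N` through `Cˢ` and `x` is a
non-zero-divisor on `N`, then `M₁ = ι(N) + ker π ≤ Cˢ` is `x`-sandwiched (`x • Cˢ ≤ M₁`) and
`N × ker π ≃ M₁` via `(n, k) ↦ ι n + k`. [folklore] -/
theorem exists_sandwich_of_comp_eq_smul_id {N : Type u} [AddCommGroup N] [Module C N] {x : C}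
    {s : ℕ} (ι : N →ₗ[C] (Fin s → C)) (π : (Fin s → C) →ₗ[C] N)
    (h : π ∘ₗ ι = x • LinearMap.id) (hx : ∀ n : N, x • n = 0 → n = 0) :
    ∃ M₁ : Submodule C (Fin s → C),
      (∀ v : Fin s → C, x • v ∈ M₁) ∧ Nonempty ((N × LinearMap.ker π) ≃ₗ[C] M₁) := by
  have hπι : ∀ n : N, π (ι n) = x • n := fun n => LinearMap.congr_fun h n
  let M₁ : Submodule C (Fin s → C) := LinearMap.range ι ⊔ LinearMap.ker π
  -- the comparison map `(n, k) ↦ ι n + k`, landing in `M₁`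
  let φ : N × LinearMap.ker π →ₗ[C] (Fin s → C) :=
    ι.coprod (LinearMap.ker π).subtype
  have hφmem : ∀ p : N × LinearMap.ker π, φ p ∈ M₁ := fun p =>
    Submodule.add_mem _ (Submodule.mem_sup_left ⟨p.1, rfl⟩) (Submodule.mem_sup_right p.2.2)
  let φ' : N × LinearMap.ker π →ₗ[C] M₁ := LinearMap.codRestrict M₁ φ hφmem
  have hinj : Function.Injective φ' := by
    rw [← LinearMap.ker_eq_bot, LinearMap.ker_eq_bot']
    rintro ⟨n, k⟩ hnk
    have hsum : ι n + (k : Fin s → C) = 0 := by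
      have := congrArg Subtype.val hnk
      simpa [φ', φ] using this
    have hn : x • n = 0 := by
      have := congrArg π hsum
      rwa [map_add, hπι, k.2, add_zero, map_zero] at this
    have hn0 : n = 0 := hx n hn
    have hk0 : (k : Fin s → C) = 0 := by rwa [hn0, map_zero, zero_add] at hsum
    exact Prod.ext hn0 (Subtype.ext hk0)
  have hsurj : Function.Surjective φ' := by
    rintro ⟨v, hv⟩
    obtain ⟨y, hy, z, hz, rfl⟩ := Submodule.mem_sup.mp hv
    obtain ⟨n, rfl⟩ := hy
    exact ⟨(n, ⟨z, hz⟩), Subtype.ext rfl⟩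
  refine ⟨M₁, fun v => ?_, ⟨LinearEquiv.ofBijective φ' ⟨hinj, hsurj⟩⟩⟩
  -- `x v = ι (π v) + (x v - ι (π v))` with the second summand in `ker π`
  have hker : x • v - ι (π v) ∈ LinearMap.ker π := by
    rw [LinearMap.mem_ker, map_sub, map_smul, hπι, sub_self]
  have : x • v = ι (π v) + (x • v - ι (π v)) := by abel
  rw [this]
  exact Submodule.add_mem _ (Submodule.mem_sup_left ⟨π v, rfl⟩) (Submodule.mem_sup_right hker)

end Summit.ResolutionOfSingularities.ResolutionOfSingularities.Theorems.HomologicalConductor.PersistenceSandwich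

end
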